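import Summits.CriticalPhenomena.PercolationContinuityZ3.Theorems.PercNearOneGluingAdditiveGluingK0CovTransferQOfSDMarkov
import Literature.Probability.Percolation.TwoClusterExchange
import HarnessLib

/-!
# Crux `PercNearOneGluing.AdditiveGluing` (stmt-CriticalPhenomena-4576): the kernel (T) follows from the dominance statement (SD)

Support file (`--supports stmt-CriticalPhenomena-4576`, helper; depth seat (d) exchange-certificate form).
No definitions, no named facts, no sorries.

Weighted graph on `Fin n` (`μ = prodBernoulli w`), relays `u, v`, target `b`, observer `o`, spectator `c`; `D = {u ↮ v}`,
`N = {c ↮ u} ∩ {c ↮ v}`, `L = C_v` (open edge cluster).  The registered kernel stub of the three-relay half,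
`stub_k0CovTransferQ_c9` (= (T), hypothesis `hQ` of `k0CovTransferP_of_Q`, p-landed by lead c10), reads
  (T)  `μ(D)·(μ(D∩ub∩vo)·μ(N) − μ(D∩ub∩vc)·μ(N∩oc)) ≤ μ(D∩ub)·(μ(D∩vo)·μ(N) − μ(D∩vc)·μ(N∩oc))`.
Lead c11 (`LeadMath-c11` §1–§2) reduced it on paper to the L-face dominance statement
  (SD)  for every event `U` increasing in `C_v`:
        `μ(D∩N∩oc)·(μ(D)·μ(D∩U∩vc) − μ(D∩U)·μ(D∩vc)) ≤ μ(D∩N)·(μ(D)·μ(D∩U∩vo) − μ(D∩U)·μ(D∩vo))`,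
i.e. `Cov_D(1_U, 1{o∈L}) ≥ P_D(o↔c | c free)·Cov_D(1_U, 1{c∈L})`, of which the cases `U` comparable with `{c ∈ L}` are proved in
`PercNearOneGluingAdditiveGluingThreePointTransferUpset.lean`.  This file proves the reduction in the tree (the domain-Markov tool `real_D_E_ub_eq_sum` & co. is in
`PercNearOneGluingAdditiveGluingK0CovTransferQOfSDMarkov.lean`):

* `covTransferD_of_SD` : (SD) ⟹ (T_D), the all-conditional transfer
  `μ(D∩N)·(μ(D)·μ(D∩ub∩vo) − μ(D∩ub)·μ(D∩vo)) ≤ μ(D∩N∩oc)·(μ(D)·μ(D∩ub∩vc) − μ(D∩ub)·μ(D∩vc))`.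
  Proof (domain Markov property, van den Berg–Häggström–Kahn's display (10), in the tree `BHK2006.sum_cond_cluster`):
  conditionally on `C_v`, `{u ↔ b}` is the event that `b` is joined to `u` in fresh variables `η` off `C̄_v`; for each auxiliary
  configuration `η` the event `U_η = {ω | u ↮ b in η ∖ C̄_v(ω)}` is increasing in `C_v(ω)`, and
  `μ(D∩ub∩E) = Σ_η weight(η)·(μ(D∩E) − μ(D∩E∩U_η))` for `E ∈ {Ω, v↔o, v↔c}`; so both covariances are `−Σ_η weight(η)·[same with U_η]`
  and (T_D) is the `weight(η)`-average of (SD) at `U_η`.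
* `k0CovTransferQ_of_SD` : (SD) + the attachment transfer on `D` (registered stub `stub_k0AttachTransferD_c10`, landed p183587, taken
  as hypothesis `hA` exactly as in `k0CovTransferP_of_Q`) ⟹ (T) at all tuples, i.e. the registered signature of `stub_k0CovTransferQ_c9`.
  Proof: (T_D), `Cov_D(ub, vc) ≤ 0` (BHK Thm. 1.5, `twoClusterExchange`), and `μ(D∩N)·μ(N∩oc) ≤ μ(D∩N∩oc)·μ(N)` (= `hA`); the degenerate
  case `μ(D∩N) = 0` forces `μ(D)·μ(N) = 0` (the configuration of sure edges lies in `D ∩ N` whenever both are non-null).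
[cite: VandenbergHaggstromKahn2005, Thm. 1.5 (p. 7), proof pp. 7–8 display (10)] [cite: KozmaNitzan2024, Lemma 4 (p. 9), Question 7 (p. 36)]
-/

namespace Summit.CriticalPhenomena.PercolationContinuityZ3.Theorems

open MeasureTheory Set Literature.Probability.LatticeModels Literature.Probability.Percolation
open Literature.Probability.Percolation.BHK2006 (weight weight_nonneg integral_prodBernoulli_eq_sum sum_cond_cluster bar_mono
  openEdgeCluster_mono)
open Literature.Probability.Percolation.DecisionTree (ind ind_of_mem ind_of_not_mem ind_nonneg)

noncomputable section

open K0CovTransferQOfSD in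
/-- **(SD) ⟹ (T_D)**: if the dominance statement (SD) holds for every event increasing in `C_v` (hypothesis `hSD`), then
`μ(D∩N)·(μ(D)·μ(D∩ub∩vo) − μ(D∩ub)·μ(D∩vo)) ≤ μ(D∩N∩oc)·(μ(D)·μ(D∩ub∩vc) − μ(D∩ub)·μ(D∩vc))`
(`D = {u↮v}`, `N = {c↮u}∩{c↮v}`), i.e. `P_D(c free)·Cov_D(1{b∈C_u}, 1{o∈C_v}) ≤ P_D(c free, o↔c)·Cov_D(1{b∈C_u}, 1{c∈C_v})`.
The two covariances are `−Σ_η weight(η)·[the same with 1{b∈C_u} replaced by the C_v-increasing event U_η]`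
(`real_D_conn_ub_eq`, `real_D_ub_eq`), so (T_D) is the `weight`-average of (SD) at `U = U_η`.
[cite: VandenbergHaggstromKahn2005, §1 pp. 7–8, display (10)] -/
theorem covTransferD_of_SD
    (hSD : ∀ (n : ℕ) (w : Sym2 (Fin n) → unitInterval) (o u v c : Fin n) (U : Set (BondConfig (Fin n))),
      (∀ ⦃ω ω' : BondConfig (Fin n)⦄, openEdgeCluster ω v ⊆ openEdgeCluster ω' v → ω ∈ U → ω' ∈ U) →
      (prodBernoulli w).real ((openConn u v)ᶜ ∩ ((openConn c u)ᶜ ∩ (openConn c v)ᶜ) ∩ openConn o c :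
            Set (BondConfig (Fin n))) *
          ((prodBernoulli w).real ((openConn u v)ᶜ : Set (BondConfig (Fin n))) *
              (prodBernoulli w).real ((openConn u v)ᶜ ∩ U ∩ openConn v c : Set (BondConfig (Fin n))) -
            (prodBernoulli w).real ((openConn u v)ᶜ ∩ U : Set (BondConfig (Fin n))) *
              (prodBernoulli w).real ((openConn u v)ᶜ ∩ openConn v c : Set (BondConfig (Fin n)))) ≤
        (prodBernoulli w).real ((openConn u v)ᶜ ∩ ((openConn c u)ᶜ ∩ (openConn c v)ᶜ) : Set (BondConfig (Fin n))) *
          ((prodBernoulli w).real ((openConn u v)ᶜ : Set (BondConfig (Fin n))) *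
              (prodBernoulli w).real ((openConn u v)ᶜ ∩ U ∩ openConn v o : Set (BondConfig (Fin n))) -
            (prodBernoulli w).real ((openConn u v)ᶜ ∩ U : Set (BondConfig (Fin n))) *
              (prodBernoulli w).real ((openConn u v)ᶜ ∩ openConn v o : Set (BondConfig (Fin n))))) :
    ∀ (n : ℕ) (w : Sym2 (Fin n) → unitInterval) (o b u v c : Fin n),
      (prodBernoulli w).real ((openConn u v)ᶜ ∩ ((openConn c u)ᶜ ∩ (openConn c v)ᶜ) : Set (BondConfig (Fin n))) *
          ((prodBernoulli w).real ((openConn u v)ᶜ : Set (BondConfig (Fin n))) *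
              (prodBernoulli w).real ((openConn u v)ᶜ ∩ openConn u b ∩ openConn v o : Set (BondConfig (Fin n))) -
            (prodBernoulli w).real ((openConn u v)ᶜ ∩ openConn u b : Set (BondConfig (Fin n))) *
              (prodBernoulli w).real ((openConn u v)ᶜ ∩ openConn v o : Set (BondConfig (Fin n)))) ≤
        (prodBernoulli w).real ((openConn u v)ᶜ ∩ ((openConn c u)ᶜ ∩ (openConn c v)ᶜ) ∩ openConn o c :
            Set (BondConfig (Fin n))) *
          ((prodBernoulli w).real ((openConn u v)ᶜ : Set (BondConfig (Fin n))) *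
              (prodBernoulli w).real ((openConn u v)ᶜ ∩ openConn u b ∩ openConn v c : Set (BondConfig (Fin n))) -
            (prodBernoulli w).real ((openConn u v)ᶜ ∩ openConn u b : Set (BondConfig (Fin n))) *
              (prodBernoulli w).real ((openConn u v)ᶜ ∩ openConn v c : Set (BondConfig (Fin n)))) := by
  intro n w o b u v c
  set μ := prodBernoulli w with hμ
  set w' : Sym2 (Fin n) → ℝ := fun e => (w e : ℝ) with hw'
  set d := μ.real ((openConn u v)ᶜ : Set (BondConfig (Fin n))) with hd
  set t := μ.real ((openConn u v)ᶜ ∩ ((openConn c u)ᶜ ∩ (openConn c v)ᶜ) : Set (BondConfig (Fin n))) with ht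
  set toc := μ.real ((openConn u v)ᶜ ∩ ((openConn c u)ᶜ ∩ (openConn c v)ᶜ) ∩ openConn o c : Set (BondConfig (Fin n)))
    with htoc
  set dvo := μ.real ((openConn u v)ᶜ ∩ openConn v o : Set (BondConfig (Fin n))) with hdvo
  set pc := μ.real ((openConn u v)ᶜ ∩ openConn v c : Set (BondConfig (Fin n))) with hpc
  -- per-η quantities
  set fU : Set (Sym2 (Fin n)) → ℝ := fun η => μ.real ((openConn u v)ᶜ ∩ ({ω' | b = u ∨ ∃ e ∈ openEdgeCluster (η \ {d | ∃ y ∈ d, y = v ∨ ∃ d' ∈ openEdgeCluster ω' v, y ∈ d'}) u, b ∈ e} : Set (BondConfig (Fin n)))ᶜ : Set (BondConfig (Fin n)))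
    with hfU
  set fUo : Set (Sym2 (Fin n)) → ℝ := fun η =>
    μ.real ((openConn u v)ᶜ ∩ ({ω' | b = u ∨ ∃ e ∈ openEdgeCluster (η \ {d | ∃ y ∈ d, y = v ∨ ∃ d' ∈ openEdgeCluster ω' v, y ∈ d'}) u, b ∈ e} : Set (BondConfig (Fin n)))ᶜ ∩ openConn v o : Set (BondConfig (Fin n))) with hfUo
  set fUc : Set (Sym2 (Fin n)) → ℝ := fun η =>
    μ.real ((openConn u v)ᶜ ∩ ({ω' | b = u ∨ ∃ e ∈ openEdgeCluster (η \ {d | ∃ y ∈ d, y = v ∨ ∃ d' ∈ openEdgeCluster ω' v, y ∈ d'}) u, b ∈ e} : Set (BondConfig (Fin n)))ᶜ ∩ openConn v c : Set (BondConfig (Fin n))) with hfUc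
  have hB : μ.real ((openConn u v)ᶜ ∩ openConn u b : Set (BondConfig (Fin n))) = ∑ η, weight w' η * (d - fU η) :=
    real_D_ub_eq w b u v
  have hBo : μ.real ((openConn u v)ᶜ ∩ openConn u b ∩ openConn v o : Set (BondConfig (Fin n))) =
      ∑ η, weight w' η * (dvo - fUo η) := real_D_conn_ub_eq w o b u v
  have hBc : μ.real ((openConn u v)ᶜ ∩ openConn u b ∩ openConn v c : Set (BondConfig (Fin n))) =
      ∑ η, weight w' η * (pc - fUc η) := real_D_conn_ub_eq w c b u v
  have hm : ∑ ω, weight w' ω = 1 := s1gen_sum_weight w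
  -- (SD) at each `U_η`
  have hη : ∀ η, 0 ≤ weight w' η * (t * (d * fUo η - fU η * dvo) - toc * (d * fUc η - fU η * pc)) := by
    intro η
    refine mul_nonneg (weight_nonneg (fun e => (w e).2.1) (fun e => (w e).2.2) η) (sub_nonneg.2 ?_)
    exact hSD n w o u v c ({ω' | b = u ∨ ∃ e ∈ openEdgeCluster (η \ {d | ∃ y ∈ d, y = v ∨ ∃ d' ∈ openEdgeCluster ω' v, y ∈ d'}) u, b ∈ e} : Set (BondConfig (Fin n)))ᶜ (compl_Vaux_mono u v b η)
  have hsum := Finset.sum_nonneg fun η (_ : η ∈ Finset.univ) => hη η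
  -- rewrite the goal as that sum
  rw [hB, hBo, hBc]
  have e1 : ∀ g : Set (Sym2 (Fin n)) → ℝ, ∀ a : ℝ,
      ∑ η, weight w' η * (a - g η) = a - ∑ η, weight w' η * g η := by
    intro g a
    simp only [mul_sub, Finset.sum_sub_distrib, ← Finset.sum_mul, hm, one_mul]
  have eR : ∑ η, weight w' η * (t * (d * fUo η - fU η * dvo) - toc * (d * fUc η - fU η * pc)) =
      t * d * (∑ η, weight w' η * fUo η) - t * dvo * (∑ η, weight w' η * fU η) -
        toc * d * (∑ η, weight w' η * fUc η) + toc * pc * (∑ η, weight w' η * fU η) := by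
    simp only [Finset.mul_sum, ← Finset.sum_sub_distrib, ← Finset.sum_add_distrib]
    refine Finset.sum_congr rfl fun η _ => ?_
    ring
  have expand : toc * (d * ∑ η, weight w' η * (pc - fUc η) - (∑ η, weight w' η * (d - fU η)) * pc) -
      t * (d * ∑ η, weight w' η * (dvo - fUo η) - (∑ η, weight w' η * (d - fU η)) * dvo) =
      ∑ η, weight w' η * (t * (d * fUo η - fU η * dvo) - toc * (d * fUc η - fU η * pc)) := by
    rw [e1 fUc pc, e1 fU d, e1 fUo dvo, eR]
    ring
  linarith [expand, hsum]

/-- If `μ(D ∩ N) = 0` then `μ(D)·μ(N) = 0`: on a finite weighted graph the configuration of almost-sure edges has positive mass and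
lies in every non-null decreasing event, in particular in `D ∩ N` when `D` and `N` are non-null. [folklore] -/
theorem K0CovTransferQOfSD.real_D_mul_real_N_eq_zero {n : ℕ} (w : Sym2 (Fin n) → unitInterval) (u v c : Fin n)
    (h0 : (prodBernoulli w).real ((openConn u v)ᶜ ∩ ((openConn c u)ᶜ ∩ (openConn c v)ᶜ) : Set (BondConfig (Fin n))) = 0) :
    (prodBernoulli w).real ((openConn u v)ᶜ : Set (BondConfig (Fin n))) *
      (prodBernoulli w).real ((openConn c u)ᶜ ∩ (openConn c v)ᶜ : Set (BondConfig (Fin n))) = 0 := by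
  classical
  set w' : Sym2 (Fin n) → ℝ := fun e => (w e : ℝ) with hw'
  have hw0 : ∀ e, 0 ≤ w' e := fun e => (w e).2.1
  have hw1 : ∀ e, w' e ≤ 1 := fun e => (w e).2.2
  -- the configuration of sure edges
  set ω₀ : Set (Sym2 (Fin n)) := {e | w' e = 1} with hω₀
  -- any configuration of positive weight contains ω₀
  have hsub : ∀ ω : Set (Sym2 (Fin n)), weight w' ω ≠ 0 → ω₀ ⊆ ω := by
    intro ω hω e he
    by_contra hne
    apply hω
    apply Finset.prod_eq_zero (Finset.mem_univ e)
    rw [if_neg hne, show w' e = 1 from he]; norm_num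
  -- weight of ω₀ is positive unless ... it is ∏ over e ∉ ω₀ of (1 - w' e) > 0 times ∏ over e ∈ ω₀ of 1
  have hpos : 0 < weight w' ω₀ := by
    apply Finset.prod_pos
    intro e _
    by_cases he : e ∈ ω₀
    · rw [if_pos he, show w' e = 1 from he]; norm_num
    · rw [if_neg he]
      have : w' e ≠ 1 := he
      exact sub_pos.2 (lt_of_le_of_ne (hw1 e) this)
  -- decreasing events: if ω ∈ A (A decreasing) and weight ω ≠ 0 then ω₀ ∈ A
  have hdec : ∀ A : Set (BondConfig (Fin n)), (∀ ω ω', ω' ⊆ ω → ω ∈ A → ω' ∈ A) →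
      (prodBernoulli w).real A ≠ 0 → ω₀ ∈ A := by
    intro A hA hA0
    rw [s1gen_measureReal_eq_sum] at hA0
    obtain ⟨ω, -, hω⟩ := Finset.exists_ne_zero_of_sum_ne_zero hA0
    have hωA : ω ∈ A := by
      by_contra hn; rw [ind_of_not_mem hn, mul_zero] at hω; exact hω rfl
    have hwω : weight w' ω ≠ 0 := by
      intro hz; rw [hz, zero_mul] at hω; exact hω rfl
    exact hA ω ω₀ (hsub ω hwω) hωA
  -- D and N are decreasing
  have hDdec : ∀ ω ω' : BondConfig (Fin n), ω' ⊆ ω → ω ∈ ((openConn u v)ᶜ : Set (BondConfig (Fin n))) →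
      ω' ∈ ((openConn u v)ᶜ : Set (BondConfig (Fin n))) :=
    fun ω ω' h hω hr => hω (hr.mono (BHK2006.openGraph_le h))
  have hNdec : ∀ ω ω' : BondConfig (Fin n), ω' ⊆ ω →
      ω ∈ ((openConn c u)ᶜ ∩ (openConn c v)ᶜ : Set (BondConfig (Fin n))) →
      ω' ∈ ((openConn c u)ᶜ ∩ (openConn c v)ᶜ : Set (BondConfig (Fin n))) :=
    fun ω ω' h hω => ⟨fun hr => hω.1 (hr.mono (BHK2006.openGraph_le h)), fun hr => hω.2 (hr.mono (BHK2006.openGraph_le h))⟩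
  by_contra hne
  rcases mul_ne_zero_iff.1 hne with ⟨hD, hN⟩
  have h1 := hdec _ hDdec hD
  have h2 := hdec _ hNdec hN
  -- then ω₀ ∈ D ∩ N has positive weight, contradicting h0
  set S : Set (BondConfig (Fin n)) := (openConn u v)ᶜ ∩ ((openConn c u)ᶜ ∩ (openConn c v)ᶜ) with hS
  have hmem : ω₀ ∈ S := ⟨h1, h2⟩
  have hterm : 0 < weight w' ω₀ * ind S ω₀ := by rw [ind_of_mem hmem, mul_one]; exact hpos
  have hle : weight w' ω₀ * ind S ω₀ ≤ ∑ ω, weight w' ω * ind S ω :=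
    Finset.single_le_sum (f := fun ω => weight w' ω * ind S ω)
      (fun ω _ => mul_nonneg (weight_nonneg hw0 hw1 ω) (ind_nonneg _ ω)) (Finset.mem_univ ω₀)
  rw [s1gen_measureReal_eq_sum] at h0
  linarith

open K0CovTransferQOfSD in
/-- **(SD) + (γ″) ⟹ (T) at all tuples** — the registered kernel stub `stub_k0CovTransferQ_c9` from the dominance statement (SD)
(hypothesis `hSD`) and the landed attachment transfer on `D` (`stub_k0AttachTransferD_c10`, p183587, hypothesis `hA`, verbatim as in
`k0CovTransferP_of_Q`):  `μ(D)·(μ(D∩ub∩vo)·μ(N) − μ(D∩ub∩vc)·μ(N∩oc)) ≤ μ(D∩ub)·(μ(D∩vo)·μ(N) − μ(D∩vc)·μ(N∩oc))`.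
Proof: (T_D) (`covTransferD_of_SD`), `μ(D∩ub∩vc)·μ(D) ≤ μ(D∩ub)·μ(D∩vc)` (BHK Thm. 1.5, `twoClusterExchange`), `hA`, and
`real_D_mul_real_N_eq_zero` for the degenerate case `μ(D∩N) = 0`.  So the three-relay kernel is implied by (SD).
[cite: VandenbergHaggstromKahn2005, Thm. 1.5 (p. 7)] [cite: KozmaNitzan2024, Lemma 4 (p. 9), Question 7 (p. 36)] -/
theorem k0CovTransferQ_of_SD
    (hSD : ∀ (n : ℕ) (w : Sym2 (Fin n) → unitInterval) (o u v c : Fin n) (U : Set (BondConfig (Fin n))),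
      (∀ ⦃ω ω' : BondConfig (Fin n)⦄, openEdgeCluster ω v ⊆ openEdgeCluster ω' v → ω ∈ U → ω' ∈ U) →
      (prodBernoulli w).real ((openConn u v)ᶜ ∩ ((openConn c u)ᶜ ∩ (openConn c v)ᶜ) ∩ openConn o c :
            Set (BondConfig (Fin n))) *
          ((prodBernoulli w).real ((openConn u v)ᶜ : Set (BondConfig (Fin n))) *
              (prodBernoulli w).real ((openConn u v)ᶜ ∩ U ∩ openConn v c : Set (BondConfig (Fin n))) -
            (prodBernoulli w).real ((openConn u v)ᶜ ∩ U : Set (BondConfig (Fin n))) *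
              (prodBernoulli w).real ((openConn u v)ᶜ ∩ openConn v c : Set (BondConfig (Fin n)))) ≤
        (prodBernoulli w).real ((openConn u v)ᶜ ∩ ((openConn c u)ᶜ ∩ (openConn c v)ᶜ) : Set (BondConfig (Fin n))) *
          ((prodBernoulli w).real ((openConn u v)ᶜ : Set (BondConfig (Fin n))) *
              (prodBernoulli w).real ((openConn u v)ᶜ ∩ U ∩ openConn v o : Set (BondConfig (Fin n))) -
            (prodBernoulli w).real ((openConn u v)ᶜ ∩ U : Set (BondConfig (Fin n))) *
              (prodBernoulli w).real ((openConn u v)ᶜ ∩ openConn v o : Set (BondConfig (Fin n)))))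
    (hA : ∀ (n : ℕ) (w : Sym2 (Fin n) → unitInterval) (o u v c : Fin n),
      (prodBernoulli w).real ((openConn u v)ᶜ ∩ ((openConn c u)ᶜ ∩ (openConn c v)ᶜ) : Set (BondConfig (Fin n))) *
          (prodBernoulli w).real ((openConn c u)ᶜ ∩ (openConn c v)ᶜ ∩ openConn o c : Set (BondConfig (Fin n))) ≤
        (prodBernoulli w).real ((openConn u v)ᶜ ∩ ((openConn c u)ᶜ ∩ (openConn c v)ᶜ) ∩ openConn o c : Set (BondConfig (Fin n))) *
          (prodBernoulli w).real ((openConn c u)ᶜ ∩ (openConn c v)ᶜ : Set (BondConfig (Fin n)))) :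
    ∀ (n : ℕ) (w : Sym2 (Fin n) → unitInterval) (o b u v c : Fin n), (Literature.Probability.LatticeModels.prodBernoulli w).real ((Literature.Probability.Percolation.openConn u v)ᶜ : Set (Literature.Probability.Percolation.BondConfig (Fin n))) * ((Literature.Probability.LatticeModels.prodBernoulli w).real ((Literature.Probability.Percolation.openConn u v)ᶜ ∩ Literature.Probability.Percolation.openConn u b ∩ Literature.Probability.Percolation.openConn v o : Set (Literature.Probability.Percolation.BondConfig (Fin n))) * (Literature.Probability.LatticeModels.prodBernoulli w).real ((Literature.Probability.Percolation.openConn c u)ᶜ ∩ (Literature.Probability.Percolation.openConn c v)ᶜ : Set (Literature.Probability.Percolation.BondConfig (Fin n))) - (Literature.Probability.LatticeModels.prodBernoulli w).real ((Literature.Probability.Percolation.openConn u v)ᶜ ∩ Literature.Probability.Percolation.openConn u b ∩ Literature.Probability.Percolation.openConn v c : Set (Literature.Probability.Percolation.BondConfig (Fin n))) * (Literature.Probability.LatticeModels.prodBernoulli w).real ((Literature.Probability.Percolation.openConn c u)ᶜ ∩ (Literature.Probability.Percolation.openConn c v)ᶜ ∩ Literature.Probability.Percolation.openConn o c : Set (Literature.Probability.Percolation.BondConfig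 (Fin n)))) ≤ (Literature.Probability.LatticeModels.prodBernoulli w).real ((Literature.Probability.Percolation.openConn u v)ᶜ ∩ Literature.Probability.Percolation.openConn u b : Set (Literature.Probability.Percolation.BondConfig (Fin n))) * ((Literature.Probability.LatticeModels.prodBernoulli w).real ((Literature.Probability.Percolation.openConn u v)ᶜ ∩ Literature.Probability.Percolation.openConn v o : Set (Literature.Probability.Percolation.BondConfig (Fin n))) * (Literature.Probability.LatticeModels.prodBernoulli w).real ((Literature.Probability.Percolation.openConn c u)ᶜ ∩ (Literature.Probability.Percolation.openConn c v)ᶜ : Set (Literature.Probability.Percolation.BondConfig (Fin n))) - (Literature.Probability.LatticeModels.prodBernoulli w).real ((Literature.Probability.Percolation.openConn u v)ᶜ ∩ Literature.Probability.Percolation.openConn v c : Set (Literature.Probability.Percolation.BondConfig (Fin n))) * (Literature.Probability.LatticeModels.prodBernoulli w).real ((Literature.Probability.Percolation.openConn c u)ᶜ ∩ (Literature.Probability.Percolation.openConn c v)ᶜ ∩ Literature.Probability.Percolation.openConn o c : Set (Literature.Probability.Percolation.BondConfig (Fin n)))) := by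
  intro n w o b u v c
  have hTD := covTransferD_of_SD hSD n w o b u v c
  have hγ := hA n w o u v c
  set μ := prodBernoulli w with hμ
  set d := μ.real ((openConn u v)ᶜ : Set (BondConfig (Fin n))) with hd
  set t := μ.real ((openConn u v)ᶜ ∩ ((openConn c u)ᶜ ∩ (openConn c v)ᶜ) : Set (BondConfig (Fin n))) with ht
  set toc := μ.real ((openConn u v)ᶜ ∩ ((openConn c u)ᶜ ∩ (openConn c v)ᶜ) ∩ openConn o c : Set (BondConfig (Fin n)))
    with htoc
  set Nn := μ.real ((openConn c u)ᶜ ∩ (openConn c v)ᶜ : Set (BondConfig (Fin n))) with hNn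
  set NJ := μ.real ((openConn c u)ᶜ ∩ (openConn c v)ᶜ ∩ openConn o c : Set (BondConfig (Fin n))) with hNJ
  set dB := μ.real ((openConn u v)ᶜ ∩ openConn u b : Set (BondConfig (Fin n))) with hdB
  set dBo := μ.real ((openConn u v)ᶜ ∩ openConn u b ∩ openConn v o : Set (BondConfig (Fin n))) with hdBo
  set dBc := μ.real ((openConn u v)ᶜ ∩ openConn u b ∩ openConn v c : Set (BondConfig (Fin n))) with hdBc
  set dvo := μ.real ((openConn u v)ᶜ ∩ openConn v o : Set (BondConfig (Fin n))) with hdvo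
  set pc := μ.real ((openConn u v)ᶜ ∩ openConn v c : Set (BondConfig (Fin n))) with hpc
  have hd0 : 0 ≤ d := measureReal_nonneg
  have ht0 : 0 ≤ t := measureReal_nonneg
  have htoc0 : 0 ≤ toc := measureReal_nonneg
  have hNn0 : 0 ≤ Nn := measureReal_nonneg
  have hNJ0 : 0 ≤ NJ := measureReal_nonneg
  have hNJle : NJ ≤ Nn := measureReal_mono inter_subset_left
  have hdBle : dB ≤ d := measureReal_mono inter_subset_left
  have hdBole : dBo ≤ dB := measureReal_mono inter_subset_left
  have hdBcle : dBc ≤ dB := measureReal_mono inter_subset_left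
  have hdvole : dvo ≤ d := measureReal_mono inter_subset_left
  have hpcle : pc ≤ d := measureReal_mono inter_subset_left
  have hdB0 : 0 ≤ dB := measureReal_nonneg
  have hdBo0 : 0 ≤ dBo := measureReal_nonneg
  have hdBc0 : 0 ≤ dBc := measureReal_nonneg
  have hdvo0 : 0 ≤ dvo := measureReal_nonneg
  have hpc0 : 0 ≤ pc := measureReal_nonneg
  -- the goal, unfolded: d * (dBo * Nn - dBc * NJ) ≤ dB * (dvo * Nn - pc * NJ)
  show d * (dBo * Nn - dBc * NJ) ≤ dB * (dvo * Nn - pc * NJ)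
  by_cases huv : u = v
  · -- D = ∅: everything on D vanishes
    have hd : d = 0 := by
      rw [hd, huv, show ((openConn v v)ᶜ : Set (BondConfig (Fin n))) = ∅ from ?_, measureReal_empty]
      ext ω; simp only [mem_compl_iff, openConn, mem_setOf_eq, mem_empty_iff_false, iff_false, not_not]
      exact SimpleGraph.Reachable.refl v
    have hdB : dB = 0 := le_antisymm (hd ▸ hdBle) hdB0
    rw [hd, hdB]; simp
  -- BHK 1.5: `μ(D ∩ ub ∩ vc) · μ(D) ≤ μ(D ∩ ub) · μ(D ∩ vc)`
  have h15 := twoClusterExchange w (s := u) (t := v) huv (A₁ := openConn u b) (A₂ := univ)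
    (B₁ := openConn v c) (B₂ := univ)
    (typePlus_openConn u v b) (fun _ _ _ _ _ => mem_univ _)
    (typeMinus_openConn u v c) (fun _ _ _ _ _ => mem_univ _)
  simp only [inter_univ] at h15
  rw [← inter_assoc] at h15
  -- h15 : dBc * d ≤ dB * pc
  have hXc : 0 ≤ dB * pc - d * dBc := by linarith
  have key : t * (Nn * (d * dBo - dB * dvo)) ≤ t * (NJ * (d * dBc - dB * pc)) := by
    have a1 : Nn * (t * (d * dBo - dB * dvo)) ≤ Nn * (toc * (d * dBc - dB * pc)) :=
      mul_le_mul_of_nonneg_left hTD hNn0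
    have a2 : 0 ≤ (Nn * toc - t * NJ) * (dB * pc - d * dBc) := mul_nonneg (by linarith) hXc
    nlinarith
  rcases eq_or_lt_of_le ht0 with h0 | hpos
  · -- t = 0 : then d = 0 or N = 0
    rcases mul_eq_zero.1 (real_D_mul_real_N_eq_zero w u v c h0.symm) with hd' | hN'
    · have hd : d = 0 := hd'
      have hdB : dB = 0 := le_antisymm (hd ▸ hdBle) hdB0
      have hdBo : dBo = 0 := le_antisymm (hdB ▸ hdBole) hdBo0
      have hdBc : dBc = 0 := le_antisymm (hdB ▸ hdBcle) hdBc0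
      rw [hd, hdB, hdBo, hdBc]; simp
    · have hN : Nn = 0 := hN'
      have hNJ : NJ = 0 := le_antisymm (hN ▸ hNJle) hNJ0
      rw [hN, hNJ]; simp
  · have := le_of_mul_le_mul_left (by linarith [key] : t * (Nn * (d * dBo - dB * dvo)) ≤ t * (NJ * (d * dBc - dB * pc))) hpos
    nlinarith [this]
end

end Summit.CriticalPhenomena.PercolationContinuityZ3.Theorems
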